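import Summits.ResolutionOfSingularities.ResolutionOfSingularities.Theorems.HilbertSamuelEliminationSigmaMaxModificationsCorridor3WLadderIsoKernelNoetherianValuation
import Summits.ResolutionOfSingularities.ResolutionOfSingularities.Theorems.HilbertSamuelEliminationSigmaMaxModificationsCorridor3WLadderIsoKernelPerfectK3
import HarnessLib

/-!
# [OURS · L1 W4.2] KERNEL CENSUS SLICE, UNCONDITIONAL: over a PERFECT ground field NO NOETHERIAN (discrete rank-one) valuation ring dominates an
# isolated E3 point tower

Crux chain w42 (`SigmaMaxModifications`, stmt-ResolutionOfSingularities-18506; conjunct `SigmaMaxModificationsCorridor3`, stmt-…-19249),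
line `w_ladder`, registered stub `stub_isoSepRecurrent` of skeleton v8.8. Lead res-L1-w42-lead-1 (gen 6). Helper file
`--supports stmt-ResolutionOfSingularities-19249`; kernel only (no definition, no named fact).

WHAT IS PROVED. `false_of_isIsoPointTower_over_perfectField_of_noetherian_dominatesTower`: for an isolated E3 point tower over a maximal origin
with integral stages and singular marked points, whose origin stage is separated, quasi-compact and locally of finite type over a PERFECT field of
characteristic `p`, NO Noetherian valuation ring of `K(X_0)` dominates the tower (`DominatesTower`) — with NO K-row hypothesis: res-L1-w42-stub-2's
route A (`IsoTailsHS.satelliteRecurrent_of_isIsoPointTower_of_separableSteps`, p568820; separability automatic over a perfect field, as in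
`…IsoKernelPerfectK3`) makes the tower SATELLITE-RECURRENT, while a dominating Noetherian valuation ring makes it eventually NON-satellite
(`eventually_not_satellite_of_noetherian_dominates` + `not_isSatelliteStep_of_range_form`, `…IsoKernelNoetherianValuation`). Census reading: over
perfect ground fields every valuation dominating a hypothetical counterexample tower is NON-DISCRETE or of rank ≥ 2 (and, by `…IsoKernelCurveShadow`,
not composite with a curve).

HONEST FRAMING. OURS bookkeeping over tree theorems; nothing here is a statement of H. Hironaka's manuscript [Hironaka2017] nor of
[CossartJannsenSaito2020] / [CossartPiltant2009]. AI-written; AI review is weaker than expert review.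
References: V. Cossart, O. Piltant, J. Algebra 321 (2009), ch. 3 I.8.3 (ix), I.9 [CossartPiltant2009]; O. Zariski, P. Samuel, *Commutative Algebra* II,
App. 5 [ZariskiSamuel1960].
-/

noncomputable section

set_option linter.dupNamespace false

open CategoryTheory AlgebraicGeometry TopologicalSpace IsLocalRing
open Summit.ResolutionOfSingularities.ResolutionOfSingularities.Theorems.CampaignW42
open Summit.ResolutionOfSingularities.ResolutionOfSingularities.Theorems.SigmaMaxModificationsCorridor3
open Literature.AlgebraicGeometry.Resolution Literature.AlgebraicGeometry.CossartJannsenSaito2020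
open Summit.ResolutionOfSingularities.ResolutionOfSingularities.Cruxes.SigmaMaxModifications.IdeasL1Idea2R4
  (IsIsoPointTower IsoQuadraticTowerTerminates)

namespace Summit.ResolutionOfSingularities.ResolutionOfSingularities.Cruxes.SigmaMaxModifications.IdeasL1C5

universe u

variable {p : ℕ} {ν : ℕ → ℕ} {T : BlowupTower.{u}} {hint : ∀ n, IsIntegral (T.X n)} {pt : ∀ n, T.X n}

/-- Over a PERFECT ground field an isolated E3 point tower over a maximal origin is SATELLITE-RECURRENT (res-L1-w42-stub-2's route A with its
separability hypotheses discharged: every residue field is a finite extension of the perfect field, hence separable, and is itself perfect).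
[cite: CossartPiltant2009, ch. 3 I.8.3 (ix), I.9] [cite: StacksProject, Tag 01TB] -/
theorem satelliteRecurrent_of_isIsoPointTower_over_perfectField
    {k : Type u} [Field k] [CharP k p] [PerfectField k] (f : T.X 0 ⟶ Spec (.of k)) [IsSeparated f] [LocallyOfFiniteType f] [QuasiCompact f]
    (hO : IsMaximalOrigin p 3 ν (T.X 0) (pt 0)) (hT : IsIsoPointTower 3 ν T pt) :
    ∀ a, ∃ n, a ≤ n ∧ IsSatelliteStep T pt n := by
  haveI := fun n => T.ln n
  let φ₀ : CommRingCat.of k ⟶ (T.X 0).residueField (pt 0) := Spec.preimage ((T.X 0).fromSpecResidueField (pt 0) ≫ f)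
  have hφ₀ : (T.X 0).fromSpecResidueField (pt 0) ≫ f = Spec.map φ₀ := (Spec.map_preimage _).symm
  have hsep₀ : letI := φ₀.hom.toAlgebra; Algebra.IsSeparable k ((T.X 0).residueField (pt 0)) := by
    letI := φ₀.hom.toAlgebra
    haveI : Algebra.IsIntegral k ((T.X 0).residueField (pt 0)) := ⟨isIntegral_preimage_fromSpecResidueField f (hT.2.2.1 0)⟩
    exact Algebra.IsAlgebraic.isSeparable_of_perfectField
  have hperf : ∀ n, PerfectField (ResidueField ((T.X n).presheaf.stalk (pt n))) :=
    perfectField_residueField_of_isIsoPointTower hT (perfectField_residueField_of_isClosed f (hT.2.2.1 0))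
  have hsep : ∀ n, letI := ((T.π n).residueFieldMap (pt (n + 1))).hom.toAlgebra
      Algebra.IsSeparable ((T.X n).residueField ((T.π n).base (pt (n + 1)))) ((T.X (n + 1)).residueField (pt (n + 1))) := by
    intro n
    letI := ((T.π n).residueFieldMap (pt (n + 1))).hom.toAlgebra
    haveI : Algebra.IsIntegral ((T.X n).residueField ((T.π n).base (pt (n + 1)))) ((T.X (n + 1)).residueField (pt (n + 1))) :=
      ⟨isIntegral_residueFieldMap_of_isIsoPointTower hT n⟩
    haveI : PerfectField ((T.X n).residueField ((T.π n).base (pt (n + 1)))) := by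
      have h := hperf n
      rw [← hT.2.1 n] at h
      exact h
    exact Algebra.IsAlgebraic.isSeparable_of_perfectField
  exact IsoTailsHS.satelliteRecurrent_of_isIsoPointTower_of_separableSteps f hO hT φ₀ hφ₀ hsep₀ hsep

/-- **OVER A PERFECT GROUND FIELD NO NOETHERIAN VALUATION RING DOMINATES AN ISOLATED E3 POINT TOWER** (unconditional census slice: the
discrete rank-one class is empty). The tower is satellite-recurrent (`satelliteRecurrent_of_isIsoPointTower_over_perfectField`), but a dominating
Noetherian valuation ring makes it eventually non-satellite (`eventually_not_satellite_of_noetherian_dominates`, the ascending chain `t_n O`).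
[cite: CossartPiltant2009, ch. 3 I.9] [cite: ZariskiSamuel1960, App. 5] -/
theorem false_of_isIsoPointTower_over_perfectField_of_noetherian_dominatesTower
    (hsing : ∀ n, ¬ IsRegularLocalRing ((T.X n).presheaf.stalk (pt n)))
    {k : Type u} [Field k] [CharP k p] [PerfectField k] (f : T.X 0 ⟶ Spec (.of k)) [IsSeparated f] [LocallyOfFiniteType f] [QuasiCompact f]
    (hO : IsMaximalOrigin p 3 ν (T.X 0) (pt 0)) (hT : IsIsoPointTower 3 ν T pt)
    (O : ValuationSubring (T.X 0).functionField) [IsNoetherianRing O] (hdomT : DominatesTower T hint pt O) : False := by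
  haveI := hint
  haveI := fun n => T.ln n
  set Θ := towerStalkEmb T hint with hΘ
  haveI hB : ∀ n (y : T.X n), IsLocalRing (Θ n y).range := fun n y => isLocalRing_of_range_eq (Θ n y) _ rfl
  have hdom : ∀ n, SubringDominates (Θ n (pt n)).range (Θ (n + 1) (pt (n + 1))).range :=
    subringDominates_range_succ hT.2.1 (fun n => Θ n (pt n)) (fun n => towerStalkEmb_injective T hint n _)
      (towerStalkEmb_comp_stalkMap_pt T hint hT.2.1)
  obtain ⟨O', -, hQT⟩ := exists_dominatesTower T hint hT.1 hT.2.1 hT.2.2.1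
  have hprin : ∀ n, ∃ t ∈ maximalIdeal (Θ n (pt n)).range, ∀ x ∈ maximalIdeal (Θ n (pt n)).range,
      ∃ y : (Θ (n + 1) (pt (n + 1))).range, (x : (T.X 0).functionField) = y * t := by
    intro n
    obtain ⟨_, hLB⟩ := hQT n
    obtain ⟨u₀, hu₀, hgen⟩ := hLB.exists_span_singleton
    exact ⟨u₀, hu₀, fun x hx => by obtain ⟨y, hy, hxy⟩ := hgen x hx; exact ⟨⟨y, hy⟩, hxy⟩⟩
  have hne : ∀ n, maximalIdeal (Θ n (pt n)).range ≠ ⊥ := by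
    intro n h
    apply hsing n
    have hmax : ∀ a : (T.X n).presheaf.stalk (pt n), a ∈ maximalIdeal _ ↔ (⟨Θ n (pt n) a, ⟨a, rfl⟩⟩ : (Θ n (pt n)).range) ∈ maximalIdeal _ :=
      fun a => mem_maximalIdeal_iff_range (Θ n (pt n)) (towerStalkEmb_injective T hint n _) a
    have hbot : maximalIdeal ((T.X n).presheaf.stalk (pt n)) = ⊥ := by
      rw [eq_bot_iff]; intro a ha
      have := (hmax a).mp ha
      rw [h, Ideal.mem_bot] at this
      exact (Ideal.mem_bot).mpr (towerStalkEmb_injective T hint n _ (by rw [map_zero]; exact congrArg Subtype.val this))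
    exact isRegularLocalRing_of_isField ((IsLocalRing.isField_iff_maximalIdeal_eq).mpr hbot)
  obtain ⟨n₀, hn₀⟩ := eventually_not_satellite_of_noetherian_dominates hdom hprin hne O hdomT
  obtain ⟨n, hn, hsat⟩ := satelliteRecurrent_of_isIsoPointTower_over_perfectField f hO hT n₀
  exact not_isSatelliteStep_of_range_form hT.2.1 n (hn₀ n hn) hsat

end Summit.ResolutionOfSingularities.ResolutionOfSingularities.Cruxes.SigmaMaxModifications.IdeasL1C5

end
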